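/-
Copyright (c) 2026 the pub-hodgecm-mathlib formalisation cell (harness21).  Prover seat hodgecm-mathlib-F0P3a-p01 (g33), req620 Track A «(D-RAM) FOUR-FRAME» squad, unit U2H:
the (ρ2b′-X) child (U2H ED. 15 :418) — organ T3-E part 2, FILE B «EIGEN-DATA AND THE ADJOINT INVOLUTION IN A QUADRATIC MODEL» (plan `T3E-PART2-PLAN.v1` 333f6514 §2 (e)(f), §3;
payer lineage LH4-p14, O-W LH4-p12 (g4)).  2026-09-04.
-/
import Literature.NumberTheory.NumberFields.QuadraticCompletionAtNonsplitPlace   -- ★ (QM) `irreducible_X_sq_sub_C_of_not_isSquare`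
import HarnessLib

/-!
# Crux `H413`, line LH4 «(D-RAM) FOUR-FRAME» road — unit U2H, (ρ2b′-X), organ T3-E part 2, FILE B: THE EIGENVALUE `λ` AND THE ADJOINT INVOLUTION `Θ` OF A QUADRATIC MODEL

Cell `hodgecm-mathlib` (D-0151), FLOOR 0, crux item H413 = `stmt-HodgeConjecture-24833`, route of record `HCCMUnconditional`; squad F0∕P3c∕LH4; registered stub served:
`F0P3cDyRamFourFrameU2H.stub_U2H_fixedPointCensus_typeTwo_unit0` ((ρ2b′-X), U2H ED. 15 :418) through the organs of RHO2BX-ORDER v1 — here T3-E part 2 (the METRIC half of the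
line model; ★ part 1 = `F0P3cDyRamEllipticPlaneLineModel.exists_lineModel` p857255, ★ FILE A = `F0P3cDyRamEigenFieldCompletionModel.exists_completionModel` p857347).  THEOREMS ONLY
(no `def`, no instance, no notation, no `sorry`); lane `--supports stmt-HodgeConjecture-24833 --as helper` (count-neutral).

WHAT THIS FILE DOES (pure field algebra + valuations; NO number field enters).  Frame: fields `E`, `M`, ring maps `jE : E →+* M`, `ρ : M →+* M` fixing `jE(E)` pointwise, an element
`δ ∈ M` with `ρ δ = −δ`, `δ² = jE m`, `m` NOT a square in `E`, and `M = jE(E) + jE(E)·δ` (the conclusions of ★ FILE A for `M = E′_{w′}`); an involution `σ` of `E`; scalars `t D s ∈ E`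
with `t² − 4D = s²·m`, `s ≠ 0`, `D·σD = 1`, `t = D·σt` (the trace ∕ determinant of a `σ`-UNITARY `γ₂ ∈ GL₂(E)` whose discriminant lies in the square class of `m`).
* §1 `exists_ringEquiv_adjoinRoot`, `exists_ringHom_of_sq_eq`: `E[X]⁄(X² − m) ≃ M` through `δ`, hence ring maps out of `M` are prescribed by a value on `jE(E)` and a square root;
  `eq_of_coord_eq`: coordinates on `(1, δ)` are unique.
* §2 **`exists_adjointInvolution_eigenvalue`** (the algebraic package of plan §2 (e), §3): there are a ring involution `Θ` of `M` with `Θ ∘ jE = jE ∘ σ`, `Θρ = ρΘ`,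
  `Θ δ = −(s·σD∕σs)·δ`, and `λ := (t + s·δ)∕2` with `λ² = t·λ − D`, `ρ λ = t − λ`, `Θ(λ)·λ = 1`, and UNIQUE coordinates on `(1, λ)` — the binders `(hΘj, hlam, hρlam, hΘlam, hcoord)` of
  ★ part 1 and `(hΘΘ, hΘρ)` of ★ (W4) `F0P3cDyRamWSideOrderCensus`.  (`Θ` is `AdjoinRoot.lift (jE ∘ σ)` at the root `−(s·σD∕σs)·δ` of `X² − σm`; `Θ(λ) = σD·ρ(λ) = λ⁻¹`.)
* §3 the METRIC clauses (plan §2 (f)): with `Valued E ℤᵐ⁰`, `Valued M ℤᵐ⁰`, `σ` and `ρ` isometric and `|jE a| ≤ 1 ↔ |a| ≤ 1`: `v_map_eq_of_v_eq` (`jE` respects `|·|`-levels),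
  `v_eq_one_of_mul_map_self_eq_one` (`|D| = 1`), **`v_eigenvalue_eq_one`** (`|λ| = 1` from `λ·ρλ = jE D`), **`v_adjoint_eq`** (`|Θ z| = |z|`, through the norm `z·ρz ∈ jE(E)`) —
  the binders `hlam : |λ| = 1` of ★ (C) `EllipticPlaneAsFieldLine.ncard_selfDual_fixed_eq_ncard_orderLatt` and `hvΘ` of ★ (W4).
HONEST LABEL.  Count-neutral helper (pure algebra); (ρ2b′-X) stays an OPEN prover target; `HC_CM` is proved only modulo the 7 printed citations (2 remaining named inputs: hLiu418 =
`stmt-HodgeConjecture-24832`, h413 = `stmt-HodgeConjecture-24833`) until rung 0 closes.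

## References
* [Rogawski1990] J. D. Rogawski, *Automorphic Representations of Unitary Groups in Three Variables*, Ann. of Math. Stud. 123 (1990), §4.9 Lemma 4.9.3 p. 56 (the elliptic torus of a
  regular element of `U(2)`: `T ≅ E[γ]^{N = 1}`, the eigen-field `M = E(λ)` with its two commuting involutions), §3.6 pp. 28–29.
* [Jacobowitz1962] R. Jacobowitz, *Hermitian forms over local fields*, Amer. J. Math. 84 (1962), §4 (hermitian lines `Tr(h·ā·b)` over a quadratic extension; the adjoint involution).
* [Lang2002] S. Lang, *Algebra*, rev. 3rd ed., GTM 211 (2002), Ch. V §1 (`k(α) ≅ k[X]⁄(f)`, extension of homomorphisms to simple extensions).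
-/

set_option autoImplicit false

noncomputable section

open Polynomial WithZero
open Literature.NumberTheory.NumberFields (irreducible_X_sq_sub_C_of_not_isSquare)

namespace Summit.HodgeConjecture.HodgeConjecture.Cruxes.H413.F0P3cDyRamEigenFieldAdjointInvolution

variable {E M : Type} [Field E] [Field M]

/-! ## §1 The presentation `E[X]⁄(X² − m) ≃ M` through `δ`, and ring maps out of `M` -/

/-- Coordinates on `(1, δ)` are unique when `δ² = jE m` with `m` a non-square of `E`. [cite: Lang2002, Ch. V §1] -/
theorem eq_of_coord_eq (jE : E →+* M) {m : E} (hm : ¬ IsSquare m) {δ : M} (hδ : δ ^ 2 = jE m)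
    {p q p' q' : E} (h : jE p + jE q * δ = jE p' + jE q' * δ) : p = p' ∧ q = q' := by
  by_cases hq : q = q'
  · subst hq
    exact ⟨jE.injective (add_right_cancel h), rfl⟩
  · exfalso
    have hqq : jE (q - q') ≠ 0 := (map_ne_zero jE).2 (sub_ne_zero.2 hq)
    have hδe : δ = jE ((p' - p) / (q - q')) := by
      rw [map_div₀, eq_div_iff hqq, map_sub, map_sub]
      linear_combination h
    apply hm
    refine ⟨(p' - p) / (q - q'), jE.injective ?_⟩
    rw [map_mul, ← hδe, ← hδ, sq]

/-- **`E[X]⁄(X² − m) ≃ M` THROUGH `δ`**: if `δ² = jE m`, `m` is a non-square of `E` and `M = jE(E) + jE(E)·δ`, then `AdjoinRoot.lift jE δ` is a ring isomorphism `e` with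
`e ∘ of = jE`, `e(root) = δ` (injective: the source is a field; surjective: the coordinates). [cite: Lang2002, Ch. V §1] -/
theorem exists_ringEquiv_adjoinRoot (jE : E →+* M) {m : E} (hm : ¬ IsSquare m) {δ : M} (hδ : δ ^ 2 = jE m)
    (hspan : ∀ z : M, ∃ pq : E × E, z = jE pq.1 + jE pq.2 * δ) :
    ∃ e : AdjoinRoot (X ^ 2 - C m) ≃+* M, (∀ a : E, e (AdjoinRoot.of (X ^ 2 - C m) a) = jE a) ∧ e (AdjoinRoot.root (X ^ 2 - C m)) = δ := by
  have hroot : (X ^ 2 - C m).eval₂ jE δ = 0 := by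
    rw [eval₂_sub, eval₂_X_pow, eval₂_C, hδ, sub_self]
  let φ : AdjoinRoot (X ^ 2 - C m) →+* M := AdjoinRoot.lift jE δ hroot
  haveI : Fact (Irreducible (X ^ 2 - C m)) := ⟨irreducible_X_sq_sub_C_of_not_isSquare m hm⟩
  have hinj : Function.Injective φ := φ.injective
  have hsurj : Function.Surjective φ := by
    intro z
    obtain ⟨pq, hpq⟩ := hspan z
    refine ⟨AdjoinRoot.of _ pq.1 + AdjoinRoot.of _ pq.2 * AdjoinRoot.root _, ?_⟩
    rw [map_add, map_mul, AdjoinRoot.lift_of, AdjoinRoot.lift_of, AdjoinRoot.lift_root, hpq]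
  exact ⟨RingEquiv.ofBijective φ ⟨hinj, hsurj⟩, fun a => AdjoinRoot.lift_of hroot, AdjoinRoot.lift_root hroot⟩

/-- **RING MAPS OUT OF `M` ARE PRESCRIBED BY A VALUE ON `jE(E)` AND A SQUARE ROOT**: for `i : E →+* N` and `x ∈ N` with `x² = i m` there is `Ψ : M →+* N` with `Ψ ∘ jE = i`,
`Ψ δ = x`. [cite: Lang2002, Ch. V §1] -/
theorem exists_ringHom_of_sq_eq (jE : E →+* M) {m : E} (hm : ¬ IsSquare m) {δ : M} (hδ : δ ^ 2 = jE m)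
    (hspan : ∀ z : M, ∃ pq : E × E, z = jE pq.1 + jE pq.2 * δ) {N : Type} [CommRing N] (i : E →+* N) {x : N} (hx : x ^ 2 = i m) :
    ∃ Ψ : M →+* N, (∀ a : E, Ψ (jE a) = i a) ∧ Ψ δ = x := by
  obtain ⟨e, he_of, he_root⟩ := exists_ringEquiv_adjoinRoot jE hm hδ hspan
  have hroot : (X ^ 2 - C m).eval₂ i x = 0 := by
    rw [eval₂_sub, eval₂_X_pow, eval₂_C, hx, sub_self]
  refine ⟨(AdjoinRoot.lift i x hroot).comp e.symm.toRingHom, fun a => ?_, ?_⟩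
  · have h1 : e.symm (jE a) = AdjoinRoot.of (X ^ 2 - C m) a := by rw [← he_of, RingEquiv.symm_apply_apply]
    change AdjoinRoot.lift i x hroot (e.symm (jE a)) = i a
    rw [h1, AdjoinRoot.lift_of]
  · have h1 : e.symm δ = AdjoinRoot.root (X ^ 2 - C m) := by rw [← he_root, RingEquiv.symm_apply_apply]
    change AdjoinRoot.lift i x hroot (e.symm δ) = x
    rw [h1, AdjoinRoot.lift_root]

/-! ## §2 The eigenvalue `λ` and the adjoint involution `Θ` -/

/-- **T3-E FILE B — EIGEN-DATA AND THE ADJOINT INVOLUTION IN A QUADRATIC MODEL.**  Frame: `ρ ∘ jE = jE`, `ρ δ = −δ`, `δ² = jE m`, `m` a non-square, `M = jE(E) + jE(E)·δ`; `σ` an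
involution of `E`; `t D s ∈ E` with `2 ≠ 0`, `s ≠ 0`, `t² − 4D = s²m`, `D·σD = 1`, `t = D·σt` (trace and determinant of a `σ`-unitary `γ₂` of discriminant class `m`).  Then there
are a ring map `Θ : M →+* M` and `λ ∈ M` with: `Θ ∘ jE = jE ∘ σ`, `ΘΘ = id`, `Θρ = ρΘ`, `Θ δ = −(s·σD∕σs)·δ`; `2λ = t + s·δ`, `λ² = t·λ − D`, `ρ λ = t − λ`, `Θ(λ)·λ = 1`; and every
`z ∈ M` is uniquely `jE p + jE q·λ`.  [cite: Rogawski1990, §4.9 Lemma 4.9.3 p. 56] [cite: Jacobowitz1962, §4] [cite: Lang2002, Ch. V §1] -/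
theorem exists_adjointInvolution_eigenvalue (σ : E →+* E) (hσσ : ∀ a, σ (σ a) = a) (jE : E →+* M) (ρ : M →+* M) (hρj : ∀ a, ρ (jE a) = jE a)
    {m : E} (hm : ¬ IsSquare m) {δ : M} (hδ : δ ^ 2 = jE m) (hρδ : ρ δ = -δ)
    (hspan : ∀ z : M, ∃ pq : E × E, z = jE pq.1 + jE pq.2 * δ)
    {t D s : E} (h2 : (2 : E) ≠ 0) (hs : s ≠ 0) (hΔ : t * t - 4 * D = s * s * m) (hDσ : D * σ D = 1) (htσ : t = D * σ t) :
    ∃ (Θ : M →+* M) (lam : M),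
      (∀ a, Θ (jE a) = jE (σ a)) ∧ (∀ z, Θ (Θ z) = z) ∧ (∀ z, Θ (ρ z) = ρ (Θ z)) ∧
      Θ δ = -(jE (s * σ D / σ s) * δ) ∧
      2 * lam = jE t + jE s * δ ∧
      lam * lam = jE t * lam - jE D ∧ ρ lam = jE t - lam ∧ Θ lam * lam = 1 ∧
      (∀ z : M, ∃! pq : E × E, z = jE pq.1 + jE pq.2 * lam) := by
  -- scalar bookkeeping in `E`
  have hD0 : D ≠ 0 := fun h0 => by rw [h0, zero_mul] at hDσ; exact zero_ne_one hDσ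
  have hσD : σ D = D⁻¹ := eq_inv_of_mul_eq_one_right hDσ
  have hσt : σ t = t * σ D := by
    conv_lhs => rw [htσ]
    rw [map_mul, hσσ, mul_comm]
  have hσs0 : σ s ≠ 0 := (map_ne_zero σ).2 hs
  have h2M : (2 : M) ≠ 0 := by rw [← map_ofNat jE 2]; exact (map_ne_zero jE).2 h2
  have hσm : σ m = (s * σ D / σ s) ^ 2 * m := by
    have h1 := congrArg σ hΔ
    rw [map_sub, map_mul, map_mul, map_mul, map_mul, map_ofNat, hσt, hσD] at h1
    -- clear denominators: `σs² · σm · D² = t² − 4D = s² m`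
    have h3 : σ s * σ s * σ m * (D * D) = t * t - 4 * D := by
      have e : (t * D⁻¹ * (t * D⁻¹) - 4 * D⁻¹) * (D * D) = t * t - 4 * D := by field_simp
      rw [← e, h1]
    have h4 : σ m * (σ s * σ s * (D * D)) = s * s * m := by linear_combination h3 + hΔ
    have hden : σ s * σ s * (D * D) ≠ 0 := mul_ne_zero (mul_ne_zero hσs0 hσs0) (mul_ne_zero hD0 hD0)
    rw [hσD, eq_comm]
    calc (s * D⁻¹ / σ s) ^ 2 * m = s * s * m / (σ s * σ s * (D * D)) := by field_simp
      _ = σ m := by rw [← h4, mul_div_cancel_right₀ _ hden]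
  -- `Θ := lift (jE ∘ σ)` at the root `cΘ·δ` of `X² − σm`
  set cΘ : E := -(s * σ D / σ s) with hcΘ
  have hcc : σ cΘ * cΘ = 1 := by
    rw [hcΘ, map_neg, map_div₀, map_mul, hσσ, hσσ, hσD]
    field_simp
  have hx : (jE cΘ * δ) ^ 2 = (jE.comp σ) m := by
    rw [RingHom.comp_apply, mul_pow, hδ, ← map_pow, ← map_mul, hσm, hcΘ, neg_sq]
  obtain ⟨Θ, hΘj, hΘδ⟩ := exists_ringHom_of_sq_eq jE hm hδ hspan (jE.comp σ) hx
  simp only [RingHom.comp_apply] at hΘj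
  have hΘpq : ∀ p q : E, Θ (jE p + jE q * δ) = jE (σ p) + jE (σ q * cΘ) * δ := fun p q => by
    rw [map_add, map_mul, hΘj, hΘj, hΘδ, map_mul]; ring
  have hρpq : ∀ p q : E, ρ (jE p + jE q * δ) = jE p + jE (-q) * δ := fun p q => by
    rw [map_add, map_mul, hρj, hρj, hρδ, map_neg]; ring
  -- the eigenvalue
  set lam : M := jE (2⁻¹ * t) + jE (2⁻¹ * s) * δ with hlamdef
  have h2lam : 2 * lam = jE t + jE s * δ := by
    rw [hlamdef, map_mul, map_mul, map_inv₀, map_ofNat]; field_simp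
  have hδsq : δ * δ = jE m := by rw [← sq, hδ]
  have hkey : jE (s * s * m) = jE (t * t - 4 * D) := by rw [hΔ]
  have hlam : lam * lam = jE t * lam - jE D := by
    apply mul_left_cancel₀ (mul_ne_zero h2M h2M)
    have e1 : 2 * 2 * (lam * lam) = (2 * lam) * (2 * lam) := by ring
    rw [e1, h2lam]
    have e2 : (jE t + jE s * δ) * (jE t + jE s * δ) = jE (t * t) + jE (s * s * m) + 2 * (jE t * (jE s * δ)) := by
      rw [map_mul, map_mul, map_mul, ← hδsq]; ring
    rw [e2, hkey, map_sub, map_mul, map_mul, map_ofNat]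
    have e3 : (2 : M) * 2 * (jE t * lam - jE D) = jE t * 2 * (2 * lam) - 4 * jE D := by ring
    rw [e3, h2lam]; ring
  have hρlam : ρ lam = jE t - lam := by
    rw [hlamdef, hρpq, map_neg]
    have e : t - 2⁻¹ * t = 2⁻¹ * t := by field_simp; ring
    rw [show jE t - (jE (2⁻¹ * t) + jE (2⁻¹ * s) * δ) = jE (t - 2⁻¹ * t) - jE (2⁻¹ * s) * δ by rw [map_sub]; ring, e]
    ring
  have hρlamlam : ρ lam * lam = jE D := by
    rw [hρlam]; linear_combination (-1 : M) * hlam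
  have hΘlam : Θ lam = jE (σ D) * ρ lam := by
    rw [hlamdef, hΘpq, hρpq]
    have e1 : σ (2⁻¹ * t) = σ D * (2⁻¹ * t) := by rw [map_mul, map_inv₀, map_ofNat, hσt]; ring
    have e2 : σ (2⁻¹ * s) * cΘ = σ D * (-(2⁻¹ * s)) := by
      rw [hcΘ, map_mul, map_inv₀, map_ofNat]; field_simp
    rw [e1, e2, map_mul, map_mul jE (σ D), map_neg]
    ring
  have hΘlamlam : Θ lam * lam = 1 := by
    rw [hΘlam, mul_assoc, hρlamlam, ← map_mul, mul_comm (σ D) D, hDσ, map_one]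
  refine ⟨Θ, lam, hΘj, fun z => ?_, fun z => ?_, by rw [hΘδ, hcΘ, map_neg, neg_mul], h2lam, hlam, hρlam, hΘlamlam, fun z => ?_⟩
  · -- `ΘΘ = id`
    obtain ⟨pq, rfl⟩ := hspan z
    rw [hΘpq, hΘpq, hσσ, show σ (σ pq.2 * cΘ) * cΘ = pq.2 by rw [map_mul, hσσ, mul_assoc, hcc, mul_one]]
  · -- `Θρ = ρΘ`
    obtain ⟨pq, rfl⟩ := hspan z
    rw [hρpq, hΘpq, hΘpq, hρpq, map_neg, neg_mul]
  · -- unique coordinates on `(1, λ)`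
    obtain ⟨pq, rfl⟩ := hspan z
    have hsM : jE s ≠ 0 := (map_ne_zero jE).2 hs
    have hδlam : δ = jE (s⁻¹ * 2) * lam - jE (s⁻¹ * t) := by
      apply mul_left_cancel₀ hsM
      rw [mul_sub, ← mul_assoc, ← map_mul, ← map_mul, show s * (s⁻¹ * 2) = 2 by field_simp, show s * (s⁻¹ * t) = t by field_simp,
        map_ofNat, h2lam]
      ring
    refine ⟨(pq.1 - pq.2 * (s⁻¹ * t), pq.2 * (s⁻¹ * 2)), ?_, ?_⟩
    · change jE pq.1 + jE pq.2 * δ = jE (pq.1 - pq.2 * (s⁻¹ * t)) + jE (pq.2 * (s⁻¹ * 2)) * lam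
      rw [hδlam]
      simp only [map_sub, map_mul]
      ring
    · rintro ⟨p', q'⟩ (h : jE pq.1 + jE pq.2 * δ = jE p' + jE q' * lam)
      have h' : jE pq.1 + jE pq.2 * δ = jE (p' + q' * (2⁻¹ * t)) + jE (q' * (2⁻¹ * s)) * δ := by
        rw [h, hlamdef]
        simp only [map_add, map_mul]
        ring
      obtain ⟨hp, hq⟩ := eq_of_coord_eq jE hm hδ h'
      refine Prod.ext ?_ ?_
      · change p' = pq.1 - pq.2 * (s⁻¹ * t)
        rw [hp, hq]; field_simp; ring
      · change q' = pq.2 * (s⁻¹ * 2)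
        rw [hq]; field_simp

/-! ## §3 The metric clauses: `|λ| = 1` and `Θ` is isometric -/

section Metric

variable [Valued E ℤᵐ⁰] [Valued M ℤᵐ⁰]

/-- A ring map with `|jE a| ≤ 1 ↔ |a| ≤ 1` respects value levels: `|a| = |b| ⟹ |jE a| = |jE b|`. [cite: Lang2002, Ch. V §1] -/
theorem v_map_eq_of_v_eq (jE : E →+* M) (hjv : ∀ a, Valued.v (jE a) ≤ 1 ↔ Valued.v a ≤ 1) {a b : E} (h : Valued.v a = Valued.v b) :
    Valued.v (jE a) = Valued.v (jE b) := by
  by_cases hb : b = 0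
  · subst hb
    rw [map_zero, Valuation.zero_iff] at h
    rw [h, map_zero]
  · have ha : a ≠ 0 := fun ha => by rw [ha, map_zero, eq_comm, Valuation.zero_iff] at h; exact hb h
    have hb' : Valued.v b ≠ 0 := (Valuation.ne_zero_iff _).2 hb
    have h1 : Valued.v (jE (a / b)) ≤ 1 := (hjv _).2 (by rw [map_div₀, h, div_self hb'])
    have h2 : Valued.v (jE (b / a)) ≤ 1 := (hjv _).2 (by rw [map_div₀, h, div_self hb'])
    have hjb : Valued.v (jE b) ≠ 0 := (Valuation.ne_zero_iff _).2 ((map_ne_zero jE).2 hb)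
    have hja : Valued.v (jE a) ≠ 0 := (Valuation.ne_zero_iff _).2 ((map_ne_zero jE).2 ha)
    rw [map_div₀, map_div₀, div_le_one₀ (zero_lt_iff.2 hjb)] at h1
    rw [map_div₀, map_div₀, div_le_one₀ (zero_lt_iff.2 hja)] at h2
    exact le_antisymm h1 h2

/-- `D·σD = 1` with `σ` isometric forces `|D| = 1`. [cite: Rogawski1990, §3.6 pp. 28–29] -/
theorem v_eq_one_of_mul_map_self_eq_one (σ : E →+* E) (hvσ : ∀ a, Valued.v (σ a) = Valued.v a) {D : E} (hDσ : D * σ D = 1) : Valued.v D = 1 := by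
  have h : Valued.v D ^ 2 = 1 := by
    rw [sq, ← map_one (Valued.v : Valuation E ℤᵐ⁰), ← hDσ, map_mul, hvσ]
  exact (pow_eq_one_iff_of_nonneg zero_le two_ne_zero).1 h

/-- In `ℤᵐ⁰`: `x·x = y·y ⟹ x = y`. [cite: Lang2002, Ch. V §1] -/
theorem eq_of_mul_self_eq {x y : ℤᵐ⁰} (h : x * x = y * y) : x = y := by
  rw [← sq, ← sq] at h
  exact (pow_left_inj₀ zero_le zero_le two_ne_zero).1 h

/-- **`|λ| = 1`**: an element with `λ·ρλ = jE D`, `|D| = 1`, `ρ` isometric has value `1`. [cite: Rogawski1990, §4.9 Lemma 4.9.3 p. 56] -/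
theorem v_eigenvalue_eq_one (jE : E →+* M) (hjv : ∀ a, Valued.v (jE a) ≤ 1 ↔ Valued.v a ≤ 1) (ρ : M →+* M) (hvρ : ∀ z, Valued.v (ρ z) = Valued.v z)
    {D : E} (hD : Valued.v D = 1) {lam : M} (hlamD : ρ lam * lam = jE D) : Valued.v lam = 1 := by
  have hjD : Valued.v (jE D) = 1 := by
    have h := v_map_eq_of_v_eq jE hjv (a := D) (b := 1) (by rw [hD, map_one])
    rwa [map_one, map_one] at h
  apply eq_of_mul_self_eq
  rw [one_mul, ← hjD, ← hlamD, map_mul, hvρ]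

/-- **`Θ` IS ISOMETRIC**: if `Θ ∘ jE = jE ∘ σ` with `σ`, `ρ` isometric, `Θρ = ρΘ`, `ρ` fixing `jE(E)`, `ρ δ = −δ`, `δ² = jE m`, `M = jE(E) + jE(E)·δ` and `|jE a| ≤ 1 ↔ |a| ≤ 1`, then
`|Θ z| = |z|` (through the norm `z·ρz = jE(p² − q²m)`). [cite: Rogawski1990, §4.9 Lemma 4.9.3 p. 56] [cite: Jacobowitz1962, §4] -/
theorem v_adjoint_eq (σ : E →+* E) (hvσ : ∀ a, Valued.v (σ a) = Valued.v a) (jE : E →+* M) (hjv : ∀ a, Valued.v (jE a) ≤ 1 ↔ Valued.v a ≤ 1)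
    (ρ : M →+* M) (hρj : ∀ a, ρ (jE a) = jE a) (hvρ : ∀ z, Valued.v (ρ z) = Valued.v z)
    {m : E} {δ : M} (hδ : δ ^ 2 = jE m) (hρδ : ρ δ = -δ) (hspan : ∀ z : M, ∃ pq : E × E, z = jE pq.1 + jE pq.2 * δ)
    (Θ : M →+* M) (hΘj : ∀ a, Θ (jE a) = jE (σ a)) (hΘρ : ∀ z, Θ (ρ z) = ρ (Θ z)) (z : M) : Valued.v (Θ z) = Valued.v z := by
  obtain ⟨pq, rfl⟩ := hspan z
  set w : M := jE pq.1 + jE pq.2 * δ with hw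
  have hnorm : w * ρ w = jE (pq.1 * pq.1 - pq.2 * pq.2 * m) := by
    rw [hw, map_add, map_mul, hρj, hρj, hρδ, map_sub, map_mul, map_mul, map_mul, ← hδ]; ring
  apply eq_of_mul_self_eq
  have h1 : Valued.v (Θ w) * Valued.v (Θ w) = Valued.v (jE (σ (pq.1 * pq.1 - pq.2 * pq.2 * m))) := by
    calc Valued.v (Θ w) * Valued.v (Θ w) = Valued.v (Θ w) * Valued.v (ρ (Θ w)) := by rw [hvρ]
      _ = Valued.v (Θ (w * ρ w)) := by rw [← map_mul, map_mul Θ, hΘρ]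
      _ = Valued.v (jE (σ (pq.1 * pq.1 - pq.2 * pq.2 * m))) := by rw [hnorm, hΘj]
  have h2 : Valued.v w * Valued.v w = Valued.v (jE (pq.1 * pq.1 - pq.2 * pq.2 * m)) := by
    calc Valued.v w * Valued.v w = Valued.v w * Valued.v (ρ w) := by rw [hvρ]
      _ = Valued.v (jE (pq.1 * pq.1 - pq.2 * pq.2 * m)) := by rw [← map_mul, hnorm]
  rw [h1, h2]
  exact v_map_eq_of_v_eq jE hjv (hvσ _)

end Metric

end Summit.HodgeConjecture.HodgeConjecture.Cruxes.H413.F0P3cDyRamEigenFieldAdjointInvolution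

end
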